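import Summits.HodgeConjecture.CorCM.CommonQuarticCMSubfieldOneUnsplitPair
import HarnessLib

/-!
# Common unsplit places over a common quartic subfield: the witnesses (fixed fields of involutions)

COR-CM (cell `pub-hodgecm2`, binder seat `b16` gen 50, count-neutral claim CM44-COMMONQUARTIC, file F4b; theorems only,
no definition, no named fact, no `sorry`).  NEW as packaged, hence under `Summits/`.  `HC_CM` is neither used nor
asserted.

Two CM slots `i₀, i₁` whose fields receive a quartic CM field `k` (`e₀`, `e₁`, `[K_i:ℚ] = 2[k:ℚ]`).  The NEGATIVE clause
of the `(4,4)` criterion (file F4c) is «COMMON PLACE»: a quartic totally complex subfield `F ≤ K_{i₀}` with an embedding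
`e′ : F → K_{i₁}` and a place `u : F → ℂ` UNSPLIT for `Φ_{i₀}` along the inclusion and for `Φ_{i₁}` along `e′`
(then `CorCM/CommonQuarticCMSubfieldFourfolds` makes the pair degenerate).  This file produces the witnesses:

* §1 `mem_fixedField_zpowers_iff`; **`exists_commonPlace_of_involution`** — GENERIC WITNESS: `F = Fix(σ)` for an
  involution `σ` of `K_{i₀}` (degree `4` by Artin, totally complex when it contains an anti-real element), `u = x|_F`
  for an embedding `x` with `x, x∘σ` on the same side of `Φ_{i₀}` (then `u` is unsplit along the inclusion, the fibre
  being `{x, x∘σ}`), and any `e′` along which `u` is unsplit for `Φ_{i₁}`.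
* §2 **`exists_commonPlace_of_twist`** — `σ = τ₀`: if `z₁` is unsplit for `Φ_{i₀}` along `e₀` and for `Φ_{i₁}` along
  SOME embedding `e₁′ : k → K_{i₁}` (e.g. `e₁ ∘ γ`, `γ ∈ Aut k` — the SAME PAIR over `k`, or `k` Galois), then COMMON PLACE
  (`F = e₀(k) = Fix(τ₀)`, `e′ = e₁′ ∘ e₀⁻¹`).
* §3 `exists_ringHom_forall_apply_eq` (an embedding `F → K_{i₁}` through `y⁻¹ ∘ x`), `exists_real_add_real_mul_of_fix`
  (`Fix(ρτ) = e(k⁺) ⊕ e(k⁺)b`), and **`exists_commonPlace_of_ratio_mem`** — `σ = ρ₀τ₀`: the REFLEX COINCIDENCE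
  `x₂(b₀) = f · y(b₁)`, `f ∈ F_ℝ = z(k⁺)` (the fourth ratio of F2 in `F_ℝ`; in coordinates `N(Δ)·d̄₀·d₁ ∈ (k⁺ˣ)²`)
  makes the second quartic CM subfields `k₀′ = Fix(ρ₀τ₀)`, `k₁′` isomorphic along `y⁻¹ ∘ x₂` with the COMMON unsplit
  place `x₂|_{k₀′}` — COMMON PLACE again.

## References

* [Shimura1998] G. Shimura, *Abelian Varieties with Complex Multiplication and Modular Functions*, §8.3, §8.4 (2)(C),
  §18.1.
* [Lang2002] S. Lang, *Algebra*, VI §1 Thm. 1.8 (Artin).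
* [Streng2010] M. Streng, *Complex multiplication of abelian surfaces*, Lemma I.3.4, Example I.7.5.
-/

set_option autoImplicit false

noncomputable section

open scoped ComplexConjugate
open NumberField NumberField.ComplexEmbedding Module

namespace Summit.HodgeConjecture.CorCM.OcticOverQuartic

open Literature.NumberTheory.ComplexMultiplication
open Literature.AlgebraicGeometry.Motives (CMType)
open Literature.AlgebraicGeometry.Pohlmann1968

variable {I : Type} {K : I → Type} [∀ i, Field (K i)] [∀ i, NumberField (K i)] [∀ i, IsCMField (K i)]
variable {Φ : ∀ i, CMType (K i)}

/-! ### §1 The generic witness: the fixed field of an involution -/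

section Generic

omit [∀ i, IsCMField (K i)] in
/-- `t ∈ Fix⟨σ⟩ ⟺ σ t = t`. [cite: Lang2002, VI §1] -/
theorem mem_fixedField_zpowers_iff {i : I} (σ : K i ≃ₐ[ℚ] K i) (t : K i) :
    t ∈ IntermediateField.fixedField (Subgroup.zpowers σ) ↔ σ t = t := by
  rw [IntermediateField.mem_fixedField_iff]
  constructor
  · exact fun h => h σ (Subgroup.mem_zpowers σ)
  · intro h f hf
    obtain ⟨j, rfl⟩ := Subgroup.mem_zpowers_iff.1 hf
    have h1 : t ∈ MulAction.fixedBy (K i) σ := h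
    have h2 := MulAction.mem_fixedBy_zpow h1 j
    exact h2

/-- **GENERIC WITNESS.**  `σ` an involution of `K_{i₀}` (`[K_{i₀}:ℚ] = 8`), `F = Fix(σ)`, `b ∈ F` anti-real and non-zero,
`x` an embedding with `x ∈ Φ_{i₀} ⟺ x∘σ ∈ Φ_{i₀}`, and `e′ : F → K_{i₁}` along which `u = x|_F` is unsplit for `Φ_{i₁}`
⟹ COMMON PLACE: `F` is quartic (Artin), totally complex (`b`), and `u` is unsplit for `Φ_{i₀}` along the inclusion
(its fibre is `{x, x∘σ}`). [cite: Lang2002, VI §1 Thm. 1.8] [cite: Shimura1998, §8.3] -/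
theorem exists_commonPlace_of_involution {i₀ i₁ : I} (h8 : finrank ℚ (K i₀) = 8) (σ : K i₀ ≃ₐ[ℚ] K i₀)
    (hσ1 : σ ≠ 1) (hσσ : ∀ t, σ (σ t) = t) {b : K i₀} (hbσ : σ b = b) (hb0 : b ≠ 0)
    (hρb : IsCMField.complexConj (K i₀) b = -b) (x : K i₀ →+* ℂ)
    (hx : x ∈ (Φ i₀).1 ↔ x.comp σ.toRingEquiv.toRingHom ∈ (Φ i₀).1)
    (e' : IntermediateField.fixedField (Subgroup.zpowers σ) →+* K i₁)
    (hu₁ : ∀ y y' : K i₁ →+* ℂ,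
      y.comp e' = x.comp (algebraMap (IntermediateField.fixedField (Subgroup.zpowers σ)) (K i₀)) →
      y'.comp e' = x.comp (algebraMap (IntermediateField.fixedField (Subgroup.zpowers σ)) (K i₀)) →
      (y ∈ (Φ i₁).1 ↔ y' ∈ (Φ i₁).1)) :
    ∃ (F : IntermediateField ℚ (K i₀)) (e'' : F →+* K i₁) (u : F →+* ℂ), finrank ℚ F = 4 ∧ IsTotallyComplex F ∧
      (∀ y y' : K i₀ →+* ℂ, y.comp (algebraMap F (K i₀)) = u → y'.comp (algebraMap F (K i₀)) = u →
        (y ∈ (Φ i₀).1 ↔ y' ∈ (Φ i₀).1)) ∧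
      (∀ y y' : K i₁ →+* ℂ, y.comp e'' = u → y'.comp e'' = u → (y ∈ (Φ i₁).1 ↔ y' ∈ (Φ i₁).1)) := by
  classical
  have hmem : ∀ t : K i₀, t ∈ IntermediateField.fixedField (Subgroup.zpowers σ) ↔ σ t = t :=
    mem_fixedField_zpowers_iff σ
  -- degree: Artin
  have hσ2 : σ ^ 2 = 1 := AlgEquiv.ext fun t => by rw [pow_two, AlgEquiv.mul_apply, hσσ]; rfl
  have hord : orderOf σ = 2 := orderOf_eq_prime hσ2 hσ1
  have hFK : finrank (IntermediateField.fixedField (Subgroup.zpowers σ)) (K i₀) = 2 := by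
    rw [IntermediateField.finrank_fixedField_eq_card, Nat.card_zpowers, hord]
  have hF4 : finrank ℚ (IntermediateField.fixedField (Subgroup.zpowers σ)) = 4 := by
    have h := Module.finrank_mul_finrank ℚ (IntermediateField.fixedField (Subgroup.zpowers σ)) (K i₀)
    rw [hFK, h8] at h
    omega
  have h2 : finrank ℚ (K i₀) = 2 * finrank ℚ (IntermediateField.fixedField (Subgroup.zpowers σ)) := by rw [h8, hF4]
  have hfix : ∀ t : IntermediateField.fixedField (Subgroup.zpowers σ),
      σ (algebraMap (IntermediateField.fixedField (Subgroup.zpowers σ)) (K i₀) t) =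
        algebraMap (IntermediateField.fixedField (Subgroup.zpowers σ)) (K i₀) t := fun t => (hmem t.1).1 t.2
  -- total complexity from `b`
  have htc : IsTotallyComplex (IntermediateField.fixedField (Subgroup.zpowers σ)) := by
    refine ⟨fun v => ?_⟩
    rw [← InfinitePlace.not_isReal_iff_isComplex, InfinitePlace.isReal_iff]
    intro hreal
    obtain ⟨y, hy⟩ := exists_comp_eq (algebraMap (IntermediateField.fixedField (Subgroup.zpowers σ)) (K i₀))
      v.embedding
    have h1 : conj (y b) = y b := by
      have := RingHom.congr_fun (ComplexEmbedding.isReal_iff.1 hreal) ⟨b, (hmem b).2 hbσ⟩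
      rw [← hy] at this
      exact this
    rw [← IsCMField.complexEmbedding_complexConj (K i₀) y b, hρb, map_neg] at h1
    exact hb0 ((map_eq_zero y).1 (by linear_combination h1 / (-2)))
  refine ⟨IntermediateField.fixedField (Subgroup.zpowers σ), e',
    x.comp (algebraMap (IntermediateField.fixedField (Subgroup.zpowers σ)) (K i₀)), hF4, htc,
    fun y y' hy hy' => ?_, hu₁⟩
  -- the fibre of `u` along the inclusion is `{x, x∘σ}`
  rcases (comp_eq_comp_iff (algebraMap _ (K i₀)) h2 σ hσ1 hfix x y).1 hy with hy1 | hy1 <;>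
    rcases (comp_eq_comp_iff (algebraMap _ (K i₀)) h2 σ hσ1 hfix x y').1 hy' with hy2 | hy2
  · rw [hy1, hy2]
  · rw [hy1, hy2]; exact hx
  · rw [hy1, hy2]; exact hx.symm
  · rw [hy1, hy2]

end Generic

/-! ### §2 The twist witness: the same pair over `k`, possibly along a twisted embedding -/

section Twist

variable {k : Type} [Field k] [NumberField k] [IsCMField k]

/-- **COMMON PLACE from a common unsplit place of `k` up to a twist.**  If `z₁` is unsplit for `Φ_{i₀}` along `e₀` and
for `Φ_{i₁}` along some `e₁′ : k → K_{i₁}`, then COMMON PLACE holds with `F = e₀(k) = Fix(τ₀)`, `e″ = e₁′ ∘ e₀⁻¹`,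
`u = z₁ ∘ e₀⁻¹`. [cite: Shimura1998, §8.3 and §18.1] -/
theorem exists_commonPlace_of_twist {i₀ i₁ : I} (hk : finrank ℚ k = 4) (e₀ : k →+* K i₀)
    (h8 : finrank ℚ (K i₀) = 8) (τ : K i₀ ≃ₐ[ℚ] K i₀) (hτ1 : τ ≠ 1) (hτe : ∀ x : k, τ (e₀ x) = e₀ x)
    {z₁ : k →+* ℂ} (hu₀ : ∀ y y' : K i₀ →+* ℂ, y.comp e₀ = z₁ → y'.comp e₀ = z₁ → (y ∈ (Φ i₀).1 ↔ y' ∈ (Φ i₀).1))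
    (e₁' : k →+* K i₁)
    (hu₁ : ∀ y y' : K i₁ →+* ℂ, y.comp e₁' = z₁ → y'.comp e₁' = z₁ → (y ∈ (Φ i₁).1 ↔ y' ∈ (Φ i₁).1)) :
    ∃ (F : IntermediateField ℚ (K i₀)) (e'' : F →+* K i₁) (u : F →+* ℂ), finrank ℚ F = 4 ∧ IsTotallyComplex F ∧
      (∀ y y' : K i₀ →+* ℂ, y.comp (algebraMap F (K i₀)) = u → y'.comp (algebraMap F (K i₀)) = u →
        (y ∈ (Φ i₀).1 ↔ y' ∈ (Φ i₀).1)) ∧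
      (∀ y y' : K i₁ →+* ℂ, y.comp e'' = u → y'.comp e'' = u → (y ∈ (Φ i₁).1 ↔ y' ∈ (Φ i₁).1)) := by
  classical
  have h2 : finrank ℚ (K i₀) = 2 * finrank ℚ k := by rw [h8, hk]
  have hττ := algEquiv_over_apply_apply e₀ h2 τ hτ1 hτe
  set F : IntermediateField ℚ (K i₀) := IntermediateField.fixedField (Subgroup.zpowers τ) with hF
  have hmem : ∀ t : K i₀, t ∈ F ↔ τ t = t := mem_fixedField_zpowers_iff τ
  -- `ε : k ≃ F`
  let ε : k →+* F := e₀.codRestrict F fun x => (hmem _).2 (hτe x)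
  have hεbij : Function.Bijective ε := by
    refine ⟨fun x y h => e₀.injective (by simpa [ε] using congrArg Subtype.val h), fun t => ?_⟩
    obtain ⟨x, hx⟩ := exists_apply_eq_of_fix e₀ h2 τ hτ1 hτe ((hmem t.1).1 t.2)
    exact ⟨x, Subtype.ext hx⟩
  let εe : k ≃+* F := RingEquiv.ofBijective ε hεbij
  have hεe : ∀ x : k, (algebraMap F (K i₀)) (εe x) = e₀ x := fun x => rfl
  have hεe' : ∀ t : F, e₀ (εe.symm t) = algebraMap F (K i₀) t := fun t => by
    rw [← hεe, RingEquiv.apply_symm_apply]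
  -- an anti-real element of `F`
  obtain ⟨a, ha0, ha⟩ := exists_antireal (k := k)
  obtain ⟨x, hx⟩ := exists_comp_eq e₀ z₁
  have hxτ : (x.comp τ.toRingEquiv.toRingHom).comp e₀ = z₁ := by
    rw [← hx]; exact RingHom.ext fun t => by simp only [RingHom.comp_apply]; exact congrArg x (hτe t)
  refine exists_commonPlace_of_involution h8 τ hτ1 hττ (b := e₀ a) (hτe a) ((map_ne_zero e₀).2 ha0)
    (by rw [complexConj_apply_ringHom, ha, map_neg]) x (hu₀ x _ hx hxτ) (e₁'.comp εe.symm.toRingHom)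
    fun y y' hy hy' => hu₁ y y' ?_ ?_
  · refine RingHom.ext fun v => ?_
    calc y (e₁' v) = y (e₁' (εe.symm (εe v))) := by rw [εe.symm_apply_apply]
      _ = (y.comp (e₁'.comp εe.symm.toRingHom)) (εe v) := rfl
      _ = (x.comp (algebraMap F (K i₀))) (εe v) := by rw [hy]
      _ = x (e₀ v) := rfl
      _ = z₁ v := RingHom.congr_fun hx v
  · refine RingHom.ext fun v => ?_
    calc y' (e₁' v) = y' (e₁' (εe.symm (εe v))) := by rw [εe.symm_apply_apply]
      _ = (y'.comp (e₁'.comp εe.symm.toRingHom)) (εe v) := rfl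
      _ = (x.comp (algebraMap F (K i₀))) (εe v) := by rw [hy']
      _ = x (e₀ v) := rfl
      _ = z₁ v := RingHom.congr_fun hx v

end Twist

/-! ### §3 The second-subfield witness: the reflex coincidence `x₂(b₀) = f · y(b₁)` -/

section Second

variable {k : Type} [Field k] [NumberField k] [IsCMField k]

omit [∀ i, IsCMField (K i)] in
/-- An embedding `F → K_{i₁}` through `y⁻¹ ∘ x` when `x(F) ⊆ y(K_{i₁})`. [folklore] -/
theorem exists_ringHom_forall_apply_eq {i₀ i₁ : I} (F : IntermediateField ℚ (K i₀)) (x : K i₀ →+* ℂ)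
    (y : K i₁ →+* ℂ) (h : ∀ t : K i₀, t ∈ F → x t ∈ Set.range y) :
    ∃ e' : F →+* K i₁, ∀ t : F, y (e' t) = x (algebraMap F (K i₀) t) := by
  let xF : F →ₐ[ℚ] ℂ := x.toRatAlgHom.comp F.val
  let yQ : K i₁ →ₐ[ℚ] ℂ := y.toRatAlgHom
  have hle : ∀ t : F, xF t ∈ yQ.range := fun t => by
    obtain ⟨w, hw⟩ := h t.1 t.2
    exact ⟨w, hw⟩
  let ey : K i₁ ≃ₐ[ℚ] yQ.range := AlgEquiv.ofInjectiveField yQ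
  let g : F →ₐ[ℚ] K i₁ := (ey.symm : yQ.range →ₐ[ℚ] K i₁).comp (xF.codRestrict yQ.range hle)
  have hey : ∀ w : yQ.range, y (ey.symm w) = w := fun w => by
    have h1 : ((ey (ey.symm w) : yQ.range) : ℂ) = y (ey.symm w) := rfl
    rw [← h1, AlgEquiv.apply_symm_apply]
  exact ⟨g.toRingHom, fun t => by
    change y (ey.symm (xF.codRestrict yQ.range hle t)) = x t
    rw [hey]; rfl⟩

/-- **`Fix(ρτ) = e(k⁺) ⊕ e(k⁺)·b`**: an element fixed by `ρ ∘ τ` is `e(r) + e(s)·b` with `r, s` real (`b` anti-real,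
`τ`-anti, non-zero). [cite: Shimura1998, §8.4 (2)(C)] -/
theorem exists_real_add_real_mul_of_fix {i : I} (e : k →+* K i) (h2 : finrank ℚ (K i) = 2 * finrank ℚ k)
    (τ : K i ≃ₐ[ℚ] K i) (hτ1 : τ ≠ 1) (hτe : ∀ x : k, τ (e x) = e x) {b : K i} (hb0 : b ≠ 0)
    (hρb : IsCMField.complexConj (K i) b = -b) (hτb : τ b = -b) {t : K i}
    (ht : IsCMField.complexConj (K i) (τ t) = t) :
    ∃ r s : k, IsCMField.complexConj k r = r ∧ IsCMField.complexConj k s = s ∧ t = e r + e s * b := by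
  set ρ := IsCMField.complexConj (K i) with hρ
  have hτt : τ t = ρ t := by
    have := congrArg ρ ht
    rwa [hρ, IsCMField.complexConj_apply_apply] at this
  have hτρt : τ (ρ t) = t := by rw [hρ, ← complexConj_comm]; exact ht
  -- the real part
  obtain ⟨r, hr⟩ := exists_apply_eq_of_fix e h2 τ hτ1 hτe (t := (t + ρ t) / 2)
    (by rw [map_div₀, map_add, hτt, hτρt, map_ofNat, add_comm])
  -- the `b`-part
  obtain ⟨s, hs⟩ := exists_apply_eq_of_fix e h2 τ hτ1 hτe (t := (t - ρ t) / (2 * b))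
    (by rw [map_div₀, map_sub, hτt, hτρt, map_mul, map_ofNat, hτb]; field_simp; ring)
  refine ⟨r, s, ?_, ?_, ?_⟩
  · apply e.injective
    rw [← complexConj_apply_ringHom, hr, ← hρ, map_div₀, map_add, IsCMField.complexConj_apply_apply, map_ofNat,
      add_comm]
  · apply e.injective
    rw [← complexConj_apply_ringHom, hs, ← hρ, map_div₀, map_sub, IsCMField.complexConj_apply_apply, map_mul,
      map_ofNat, hρb]
    field_simp
    ring
  · rw [hr, hs]; field_simp; ring

/-- **COMMON PLACE from the reflex coincidence.**  Slot `i₀`: `e₀, τ₀, b₀`, `x₂ ∈ Φ_{i₀}` with `x₂ ∘ τ₀ ∉ Φ_{i₀}`; slot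
`i₁`: `e₁, τ₁, b₁`, `y ∈ Φ_{i₁}` with `y ∘ τ₁ ∉ Φ_{i₁}`; `a ∈ k` anti-real.  If `x₂(b₀) = f · y(b₁)` with `f` in the real
base field `F_ℝ = normalClosure ℚ k⁺ ℂ`, then COMMON PLACE holds: `F = Fix(ρ₀τ₀)` (the second quartic CM subfield of
`K_{i₀}`), `e″ = y⁻¹ ∘ x₂` on `F`, `u = x₂|_F` (unsplit for `Φ_{i₁}` along `e″` because an embedding over `u` agrees with
`y` on `e₁(k⁺)` and at `e″(b₀) = e₁(r)b₁`). [cite: Shimura1998, §8.3 and §8.4 (2)(C)] [cite: Streng2010, Example I.7.5] -/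
theorem exists_commonPlace_of_ratio_mem {i₀ i₁ : I} (hk : finrank ℚ k = 4) {a : k} (ha0 : a ≠ 0)
    (ha : IsCMField.complexConj k a = -a) (e₀ : k →+* K i₀) (h8₀ : finrank ℚ (K i₀) = 8) (τ₀ : K i₀ ≃ₐ[ℚ] K i₀)
    (hτ1₀ : τ₀ ≠ 1) (hτe₀ : ∀ x : k, τ₀ (e₀ x) = e₀ x) {b₀ : K i₀} (hb0₀ : b₀ ≠ 0)
    (hρb₀ : IsCMField.complexConj (K i₀) b₀ = -b₀) (hτb₀ : τ₀ b₀ = -b₀) {x₂ : K i₀ →+* ℂ} (hx₂Φ : x₂ ∈ (Φ i₀).1)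
    (hx₂τ : x₂.comp τ₀.toRingEquiv.toRingHom ∉ (Φ i₀).1) (e₁ : k →+* K i₁) (h8₁ : finrank ℚ (K i₁) = 8)
    (τ₁ : K i₁ ≃ₐ[ℚ] K i₁) (hτ1₁ : τ₁ ≠ 1) (hτe₁ : ∀ x : k, τ₁ (e₁ x) = e₁ x) {b₁ : K i₁}
    (hρb₁ : IsCMField.complexConj (K i₁) b₁ = -b₁) (hτb₁ : τ₁ b₁ = -b₁) {y : K i₁ →+* ℂ} (hyΦ : y ∈ (Φ i₁).1)
    (hyτ : y.comp τ₁.toRingEquiv.toRingHom ∉ (Φ i₁).1) {f : ℂ}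
    (hf : f ∈ IntermediateField.normalClosure ℚ (maximalRealSubfield k) ℂ) (hcoin : x₂ b₀ = f * y b₁) :
    ∃ (F : IntermediateField ℚ (K i₀)) (e'' : F →+* K i₁) (u : F →+* ℂ), finrank ℚ F = 4 ∧ IsTotallyComplex F ∧
      (∀ y y' : K i₀ →+* ℂ, y.comp (algebraMap F (K i₀)) = u → y'.comp (algebraMap F (K i₀)) = u →
        (y ∈ (Φ i₀).1 ↔ y' ∈ (Φ i₀).1)) ∧
      (∀ y y' : K i₁ →+* ℂ, y.comp e'' = u → y'.comp e'' = u → (y ∈ (Φ i₁).1 ↔ y' ∈ (Φ i₁).1)) := by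
  classical
  have h2₀ : finrank ℚ (K i₀) = 2 * finrank ℚ k := by rw [h8₀, hk]
  have h2₁ : finrank ℚ (K i₁) = 2 * finrank ℚ k := by rw [h8₁, hk]
  have hCM₀ := isCMTypeWith_conj (Φ i₀)
  have hCM₁ := isCMTypeWith_conj (Φ i₁)
  have hττ₀ := algEquiv_over_apply_apply e₀ h2₀ τ₀ hτ1₀ hτe₀
  set ρ₀ := IsCMField.complexConj (K i₀) with hρ₀
  -- the involution `σ = ρ₀ τ₀`
  set σ : K i₀ ≃ₐ[ℚ] K i₀ := ρ₀.restrictScalars ℚ * τ₀ with hσ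
  have hσt : ∀ t, σ t = ρ₀ (τ₀ t) := fun t => rfl
  have hσσ : ∀ t, σ (σ t) = t := fun t => by
    rw [hσt, hσt, hρ₀, complexConj_comm, IsCMField.complexConj_apply_apply, hττ₀]
  have hσ1 : σ ≠ 1 := fun h => by
    have h1 := AlgEquiv.congr_fun h (e₀ a)
    rw [hσt, hτe₀, hρ₀, complexConj_apply_ringHom, ha, map_neg, AlgEquiv.one_apply] at h1
    exact (map_ne_zero e₀).2 ha0 (by linear_combination (-h1) / 2)
  have hσb₀ : σ b₀ = b₀ := by rw [hσt, hτb₀, map_neg, hρb₀, neg_neg]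
  have hmem : ∀ t : K i₀, t ∈ IntermediateField.fixedField (Subgroup.zpowers σ) ↔ σ t = t := mem_fixedField_zpowers_iff σ
  have hmem_e₀ : ∀ r : k, IsCMField.complexConj k r = r → σ (e₀ r) = e₀ r := fun r hr => by
    rw [hσt, hτe₀, hρ₀, complexConj_apply_ringHom, hr]
  -- `x₂` and `x₂ ∘ σ = \overline{x₂ ∘ τ₀}` are both in `Φ_{i₀}`
  have hxσ : x₂.comp σ.toRingEquiv.toRingHom = (starRingAut : ℂ ≃+* ℂ) • x₂.comp τ₀.toRingEquiv.toRingHom :=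
    RingHom.ext fun t => by
      change x₂ (σ t) = conj (x₂ (τ₀ t))
      rw [hσt, hρ₀, IsCMField.complexEmbedding_complexConj]
  have hx : x₂ ∈ (Φ i₀).1 ↔ x₂.comp σ.toRingEquiv.toRingHom ∈ (Φ i₀).1 :=
    ⟨fun _ => by rw [hxσ]; exact (hCM₀.rho_smul_mem_iff _).2 hx₂τ, fun _ => hx₂Φ⟩
  -- real elements of `ℂ` come from `k⁺` along ANY place
  set z₂ : k →+* ℂ := x₂.comp e₀ with hz₂
  set w : k →+* ℂ := y.comp e₁ with hw
  -- `x₂(Fix σ) ⊆ y(K_{i₁})`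
  have hrange : ∀ t : K i₀, t ∈ IntermediateField.fixedField (Subgroup.zpowers σ) → x₂ t ∈ Set.range y := by
    intro t ht
    obtain ⟨r, s, hr, hs, rfl⟩ := exists_real_add_real_mul_of_fix e₀ h2₀ τ₀ hτ1₀ hτe₀ hb0₀ hρb₀ hτb₀
      (t := t) (by rw [← hσt]; exact (hmem t).1 ht)
    obtain ⟨r', -, hr'⟩ := exists_apply_eq_of_mem_normalClosure hk w (apply_mem_normalClosure z₂ hr)
    obtain ⟨s', -, hs'⟩ := exists_apply_eq_of_mem_normalClosure hk w (apply_mem_normalClosure z₂ hs)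
    obtain ⟨rf, -, hrf⟩ := exists_apply_eq_of_mem_normalClosure hk w hf
    refine ⟨e₁ r' + e₁ s' * (e₁ rf * b₁), ?_⟩
    rw [map_add, map_mul, map_mul, map_add, map_mul, hcoin]
    change w r' + w s' * (w rf * y b₁) = z₂ r + z₂ s * (f * y b₁)
    rw [hr', hs', hrf]
  obtain ⟨e', he'⟩ := exists_ringHom_forall_apply_eq _ x₂ y hrange
  -- the element `b₁' = e'(b₀) = e₁(r_f) b₁`
  obtain ⟨rf, hrf_real, hrf⟩ := exists_apply_eq_of_mem_normalClosure hk w hf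
  have hb₁' : e' ⟨b₀, (hmem b₀).2 hσb₀⟩ = e₁ rf * b₁ := by
    apply y.injective
    rw [he', map_mul]
    change x₂ b₀ = y (e₁ rf) * y b₁
    rw [hcoin, ← hrf]; rfl
  have hrf0 : rf ≠ 0 := by
    rintro rfl
    rw [map_zero] at hrf
    rw [← hrf, zero_mul] at hcoin
    exact (map_ne_zero x₂).2 hb0₀ hcoin
  have hb'0 : e₁ rf * b₁ ≠ 0 := by
    refine mul_ne_zero ((map_ne_zero e₁).2 hrf0) fun h => ?_
    rw [h, map_zero, mul_zero] at hcoin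
    exact (map_ne_zero x₂).2 hb0₀ hcoin
  have hρb' : IsCMField.complexConj (K i₁) (e₁ rf * b₁) = -(e₁ rf * b₁) := by
    rw [map_mul, complexConj_apply_ringHom, hrf_real, hρb₁]; ring
  have hτb' : τ₁ (e₁ rf * b₁) = -(e₁ rf * b₁) := by rw [map_mul, hτe₁, hτb₁]; ring
  refine exists_commonPlace_of_involution h8₀ σ hσ1 hσσ hσb₀ hb0₀ hρb₀ x₂ hx e' fun y' y'' hy' hy'' => ?_
  -- every embedding over `u` along `e'` lies in `Φ_{i₁}`
  have key : ∀ v : K i₁ →+* ℂ,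
      v.comp e' = x₂.comp (algebraMap (IntermediateField.fixedField (Subgroup.zpowers σ)) (K i₀)) →
      v ∈ (Φ i₁).1 := by
    intro v hv
    have hv' : ∀ t : IntermediateField.fixedField (Subgroup.zpowers σ), v (e' t) = x₂ t.1 := fun t =>
      RingHom.congr_fun hv t
    -- agreement on `e₁(k⁺)`
    have hre : ∀ r : k, IsCMField.complexConj k r = r → v (e₁ r) = y (e₁ r) := by
      intro r hr
      obtain ⟨r₀, hr₀, hr₀'⟩ := exists_apply_eq_of_mem_normalClosure hk z₂ (apply_mem_normalClosure w hr)
      have ht : e₀ r₀ ∈ IntermediateField.fixedField (Subgroup.zpowers σ) := (hmem _).2 (hmem_e₀ r₀ hr₀)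
      have h1 : e' ⟨e₀ r₀, ht⟩ = e₁ r := y.injective ((he' _).trans hr₀')
      calc v (e₁ r) = v (e' ⟨e₀ r₀, ht⟩) := by rw [h1]
        _ = x₂ (e₀ r₀) := hv' _
        _ = y (e₁ r) := hr₀'
    -- agreement at `b₁'`
    have hyb : v (e₁ rf * b₁) = y (e₁ rf * b₁) := by
      calc v (e₁ rf * b₁) = v (e' ⟨b₀, (hmem b₀).2 hσb₀⟩) := by rw [hb₁']
        _ = x₂ b₀ := hv' _
        _ = y (e' ⟨b₀, (hmem b₀).2 hσb₀⟩) := (he' ⟨b₀, (hmem b₀).2 hσb₀⟩).symm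
        _ = y (e₁ rf * b₁) := by rw [hb₁']
    rcases eq_or_eq_conj_smul_comp_of_agree e₁ h2₁ τ₁ hτ1₁ hτe₁ ha0 ha hb'0 hρb' hτb' y v hre hyb with h | h
    · rw [h]; exact hyΦ
    · rw [h]; exact (hCM₁.rho_smul_mem_iff _).2 hyτ
  exact ⟨fun _ => key y'' hy'', fun _ => key y' hy'⟩

end Second

end Summit.HodgeConjecture.CorCM.OcticOverQuartic

end
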